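import Summits.QuantumFields.BalabanUV.Beta.D1BFx.ReducedTableF
import Summits.QuantumFields.BalabanUV.Beta.D1BFx.TorusGhostPairStencils

/-!
# `BalabanUV.Beta.D1BFx.GhostWordJetMass` — road «BF-x» for binder row D1, slot (K), DICT-CHAIN-SPEC §2 (II) row RK-GH, «RK-GH-UNIT» FILE 3a («RK-GH-JETS», generic half):
# **THE CENTRED WEIGHTED ℓ¹-MASS OF A WEIGHTED SUPERPOSITION `wsum w K` IS AT MOST `Σ'_u |w u|·(mass of K u)`; MASSES OF FINITE SUMS, SCALAR MULTIPLES,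
# AND OF THE TWO GHOST STENCILS `ghCur κ u`, `gh₂ κ u` (two unit entries on the bond)** — the currency of FILE 1a∕1b's jet letters, no `BiLoc`, no `Zl`

HONEST DEPENDENCY (cell records, verbatim): «continuum YM on T⁴ ⇐ BetaPertH ∧ nine spine estimates (0/9 proved); BetaPertH ⇐ (D1) ∧ (D4) ∧
CAP+tail; G-an2-4 gates asym, D1 and NE2/3/4.»  HONEST FRAMING (cell contract, verbatim): «discharging `BetaPertH` makes Bałaban's UV stability
UNCONDITIONAL — a real constructive-QFT result; it is NOT the continuum limit and NOT the Clay problem.»  THIS MODULE DISCHARGES NOTHING of the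
wall: [folklore] `ℓ¹` bookkeeping (Mathlib `summable_prod_of_nonneg`, `Summable.prod_symm`∕`prod_factor`∕`prod`, `norm_tsum_le_tsum_norm`, `hasSum_ite_eq`) over
an2's `OneStepResolventKernel.wsum`, the typer's `GhostStencil.ghCur` and leaf-04's `TorusGhostPairStencils.gh₂`.  Every letter is a DISPLAYED hypothesis on ARBITRARY
weights ∕ kernels; nothing about Bałaban's operators is asserted.  No `def`, no `def … : Prop`, nothing cited, 0 sorry.  NO unit row (FILE 4); 0 root-level
binders of row D1 discharged (hW ∕ hR-sockets ∕ hSX-socket ∕ D1Tel ∕ D1Rep — 0); (K) NOT closed; NOT D1, NOT `BetaPertH`, NOT continuum, NOT Clay.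

ABSOLUTE RULE (cell charter, verbatim): «No internally-minted statement may enter as a cited fact. Every hypothesis is either kernel-proved in
this package or a verbatim quotation of a PUBLISHED theorem with page reference. The manuscript(s) under audit are NOT citable for their own
disputed steps — they are the thing under adjudication; programme-internal (2001/route/tribunal) claims are never citable.»

WHY (journal INTENT 1 «RK-GH-UNIT» [D1LEAF04-G18-ONLINE]; OWNER word W-d1p2-g16-5 (B)).  FILE 1a∕1b consume the jets through ONE letter each: the centred
weighted mass `Σ'_{(x,z)} Σ_{a b} |V x z a b|·W(x,z)` (`W = e^{σ(|x − c|₁ + |z − c|₁)}` for first jets, `W = 1` for tables).  The road's packed ghost jets are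
weighted superpositions `vertexRedF n S μ y = Σ_{κ′} wsum (u ↦ wH κ′ μ (u − n•y)) (S κ′)` of BOND-SUPPORTED stencils; this file is the generic step
«mass of a superposition ≤ superposition of masses» (§1) and the stencils' own masses (§2); FILE 3b (`GhostWordJetLetters`) feeds the minimiser envelope
`RestJetEnvelopes.abs_wH_fine_le` and reads off `m_V = Cv·n`, `m_W = Cw·n⁻⁴·e^{−(κ′∕8)|y′ − y|₁}`.

CONTENT (all [folklore]; `K : Site D → MKer D F`, weights `w : Site D → ℝ`, a weight function `W : Site D × Site D → ℝ` with `0 < W`):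
* §1 **`mass_wsum_le`** (`Summable (p ↦ Σ_{ab} |K u p.1 p.2 a b|·W p)` with sum `≤ ρ u` for every `u`, `Summable (u ↦ |w u|·ρ u)` ⊢ the same for `wsum w K` with sum
  `≤ Σ'_u |w u|·ρ u`); **`mass_finset_sum_le`** (finite sums of kernels); **`mass_smul_eq`** (scalar multiples).
* §2 (`D = 4`, fibre `Unit`) **`mass_le_of_two_entries`** (a kernel dominated by two unit entries at `(p₁,q₁)`, `(p₂,q₂)` has mass `≤ W(p₁,q₁) + W(p₂,q₂)`),
  `abs_ghCur_le_two_entries`, `abs_gh₂_le_two_entries`, **`mass_ghCur_le`** ∕ **`mass_gh₂_le`** (`≤ W(u + e_κ, u) + W(u, u + e_κ)`).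
* §3 structure only: `vertexRedF_eq_sum` (the reduced vertex as `Σ_{κ′}` of superpositions), `wsum_diag_table` (the inner superposition against the
  diagonal table `[u = u′][κ′ = l′]•gh₂ κ′ u` collapses, `tsum_eq_single`), `tableRedF_gh11_eq_sum` (the packed diagonal table as sixteen single superpositions).
NOT HERE (honest): the minimiser envelope and the road jets' masses (FILE 3b), the legs (FILE 2), the rows (FILE 4).
Unit `b2b-balaban-beta-d1-formalise-leaf-04` (gen 18), D1 formalisation swarm leaf prover 04, road «BF-x»; INTENT 1 «RK-GH-UNIT» FILE 3a (journal).
-/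

noncomputable section

open Finset
open scoped BigOperators
open Literature.MathematicalPhysics.QuantumFieldTheory.Balaban1983to89
open Literature.MathematicalPhysics.QuantumFieldTheory.Balaban1983to89.Beta
open B12Sec2to5 (l1 l1_nonneg)
open ExpKernelCalculus (Site MKer)
open AffineAveraging (unitVec)
open OneStepResolventKernel (wsum)
open Summit.QuantumFields.BalabanUV.Beta.D1BFx.GhostStencil (ghCur ghCur_apply unitVec_ne_zero)
open Summit.QuantumFields.BalabanUV.Beta.D1BFx.TorusGhostPairStencils (gh₂ gh₂_apply)

namespace Summit.QuantumFields.BalabanUV.Beta.D1BFx.GhostWordJetMass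

/-! ## §1 Mass of a weighted superposition, of a finite sum, of a scalar multiple -/

section Generic

variable {D : ℕ} {F : Type*} [Fintype F]

/-- [folklore] **THE MASS OF A WEIGHTED SUPERPOSITION IS AT MOST THE SUPERPOSITION OF THE MASSES**: for a positive weight function `W` on pairs of points,
stencils `K u` with summable `W`-masses `≤ ρ u`, and weights with `Σ'_u |w u|·ρ u < ∞`, the superposition `wsum w K` has a summable `W`-mass
`≤ Σ'_u |w u|·ρ u`. -/
theorem mass_wsum_le {w : Site D → ℝ} {K : Site D → MKer D F} {W : Site D × Site D → ℝ} {ρ : Site D → ℝ} (hW : ∀ p, 0 < W p)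
    (hKs : ∀ u, Summable fun p : Site D × Site D => ∑ a, ∑ b, |K u p.1 p.2 a b| * W p)
    (hKm : ∀ u, ∑' p : Site D × Site D, ∑ a, ∑ b, |K u p.1 p.2 a b| * W p ≤ ρ u)
    (hws : Summable fun u => |w u| * ρ u) :
    (Summable fun p : Site D × Site D => ∑ a, ∑ b, |wsum w K p.1 p.2 a b| * W p) ∧
      ∑' p : Site D × Site D, ∑ a, ∑ b, |wsum w K p.1 p.2 a b| * W p ≤ ∑' u, |w u| * ρ u := by
  -- the nonnegative double family `f (u, p) := |w u|·(Σ_{ab} |K u p a b|·W p)` is summable on the product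
  set f : Site D × (Site D × Site D) → ℝ := fun q => |w q.1| * (∑ a, ∑ b, |K q.1 q.2.1 q.2.2 a b| * W q.2) with hf
  have hf0 : ∀ q, 0 ≤ f q := fun q => mul_nonneg (abs_nonneg _)
    (Finset.sum_nonneg fun a _ => Finset.sum_nonneg fun b _ => mul_nonneg (abs_nonneg _) (hW q.2).le)
  have hrow : ∀ u, ∑' p : Site D × Site D, f (u, p) ≤ |w u| * ρ u := fun u => by
    simp only [hf]; rw [tsum_mul_left]; exact mul_le_mul_of_nonneg_left (hKm u) (abs_nonneg _)
  have hfs : Summable f := by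
    refine (summable_prod_of_nonneg hf0).2 ⟨fun u => by simpa only [hf] using (hKs u).mul_left |w u|, ?_⟩
    exact Summable.of_nonneg_of_le (fun u => tsum_nonneg fun p => hf0 (u, p)) hrow hws
  have hsym := hfs.prod_symm
  -- pointwise: the `W`-weighted fibre sum of `|wsum w K|` at `p` is at most `Σ'_u f (u, p)`
  have hpt : ∀ p : Site D × Site D, ∑ a, ∑ b, |wsum w K p.1 p.2 a b| * W p ≤ ∑' u, f (u, p) := by
    intro p
    have hsec : Summable fun u => f (u, p) := hsym.prod_factor p
    -- each entry: `u ↦ |w u|·|K u p a b|` is summable (dominated by `f (u,p) ∕ W p`)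
    have hent : ∀ a b, Summable fun u => |w u| * |K u p.1 p.2 a b| := by
      intro a b
      have h1 : Summable fun u => f (u, p) * (W p)⁻¹ := hsec.mul_right _
      refine Summable.of_nonneg_of_le (fun u => mul_nonneg (abs_nonneg _) (abs_nonneg _)) (fun u => ?_) h1
      have hK1 : |K u p.1 p.2 a b| * W p ≤ ∑ a', ∑ b', |K u p.1 p.2 a' b'| * W p :=
        (Finset.single_le_sum (f := fun b' => |K u p.1 p.2 a b'| * W p) (fun _ _ => mul_nonneg (abs_nonneg _) (hW p).le)
          (Finset.mem_univ b)).trans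
          (Finset.single_le_sum (f := fun a' => ∑ b', |K u p.1 p.2 a' b'| * W p)
            (fun _ _ => Finset.sum_nonneg fun _ _ => mul_nonneg (abs_nonneg _) (hW p).le) (Finset.mem_univ a))
      show |w u| * |K u p.1 p.2 a b| ≤ |w u| * (∑ a', ∑ b', |K u p.1 p.2 a' b'| * W p) * (W p)⁻¹
      calc |w u| * |K u p.1 p.2 a b| = |w u| * (|K u p.1 p.2 a b| * W p) * (W p)⁻¹ := by
            rw [mul_assoc, mul_inv_cancel_right₀ (hW p).ne']
        _ ≤ |w u| * (∑ a', ∑ b', |K u p.1 p.2 a' b'| * W p) * (W p)⁻¹ :=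
            mul_le_mul_of_nonneg_right (mul_le_mul_of_nonneg_left hK1 (abs_nonneg _)) (inv_nonneg.2 (hW p).le)
    have habs : ∀ a b, |wsum w K p.1 p.2 a b| ≤ ∑' u, |w u| * |K u p.1 p.2 a b| := by
      intro a b
      unfold OneStepResolventKernel.wsum
      have h := norm_tsum_le_tsum_norm ((hent a b).congr fun u => by rw [Real.norm_eq_abs, abs_mul])
      rw [Real.norm_eq_abs] at h
      refine h.trans (le_of_eq (tsum_congr fun u => ?_))
      rw [Real.norm_eq_abs, abs_mul]
    calc ∑ a, ∑ b, |wsum w K p.1 p.2 a b| * W p ≤ ∑ a, ∑ b, (∑' u, |w u| * |K u p.1 p.2 a b|) * W p :=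
          Finset.sum_le_sum fun a _ => Finset.sum_le_sum fun b _ => mul_le_mul_of_nonneg_right (habs a b) (hW p).le
      _ = ∑' u, f (u, p) := by
          symm
          calc ∑' u, f (u, p) = ∑' u, ∑ a, ∑ b, |w u| * |K u p.1 p.2 a b| * W p := tsum_congr fun u => by
                show |w u| * (∑ a, ∑ b, |K u p.1 p.2 a b| * W p) = _
                rw [Finset.mul_sum]
                refine Finset.sum_congr rfl fun a _ => ?_
                rw [Finset.mul_sum]
                exact Finset.sum_congr rfl fun b _ => by ring
            _ = ∑ a, ∑' u, ∑ b, |w u| * |K u p.1 p.2 a b| * W p :=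
                Summable.tsum_finsetSum fun a _ => summable_sum fun b _ => (hent a b).mul_right (W p)
            _ = ∑ a, ∑ b, ∑' u, |w u| * |K u p.1 p.2 a b| * W p :=
                Finset.sum_congr rfl fun a _ => Summable.tsum_finsetSum fun b _ => (hent a b).mul_right (W p)
            _ = ∑ a, ∑ b, (∑' u, |w u| * |K u p.1 p.2 a b|) * W p :=
                Finset.sum_congr rfl fun a _ => Finset.sum_congr rfl fun b _ => tsum_mul_right
  -- conclude: summability by domination, the sum by Fubini
  have hcol : Summable fun p : Site D × Site D => ∑' u, f (u, p) := hsym.prod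
  have h0 : ∀ p : Site D × Site D, 0 ≤ ∑ a, ∑ b, |wsum w K p.1 p.2 a b| * W p := fun p =>
    Finset.sum_nonneg fun a _ => Finset.sum_nonneg fun b _ => mul_nonneg (abs_nonneg _) (hW p).le
  refine ⟨Summable.of_nonneg_of_le h0 hpt hcol, ?_⟩
  calc ∑' p : Site D × Site D, ∑ a, ∑ b, |wsum w K p.1 p.2 a b| * W p ≤ ∑' p : Site D × Site D, ∑' u, f (u, p) :=
        Summable.tsum_le_tsum hpt (Summable.of_nonneg_of_le h0 hpt hcol) hcol
    _ = ∑' q, f q := ((hsym.hasSum.prod_fiberwise fun p => (hsym.prod_factor p).hasSum).tsum_eq).trans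
          ((Equiv.prodComm (Site D × Site D) (Site D)).tsum_eq f)
    _ = ∑' u, ∑' p : Site D × Site D, f (u, p) := (hfs.hasSum.prod_fiberwise fun u => (hfs.prod_factor u).hasSum).tsum_eq.symm
    _ ≤ ∑' u, |w u| * ρ u := Summable.tsum_le_tsum hrow hfs.prod hws

/-- [folklore] **THE MASS OF A FINITE SUM OF KERNELS**: `Σ_{ab} |(Σ_{i∈s} K i) p a b|·W p ≤ Σ_{i∈s} Σ_{ab} |K i p a b|·W p`; hence summable with sum
`≤ Σ_{i∈s} m i` when each `K i` has a summable `W`-mass `≤ m i` (`0 ≤ W`). -/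
theorem mass_finset_sum_le {ι : Type*} (s : Finset ι) {K : ι → MKer D F} {W : Site D × Site D → ℝ} {m : ι → ℝ} (hW : ∀ p, 0 ≤ W p)
    (hKs : ∀ i ∈ s, Summable fun p : Site D × Site D => ∑ a, ∑ b, |K i p.1 p.2 a b| * W p)
    (hKm : ∀ i ∈ s, ∑' p : Site D × Site D, ∑ a, ∑ b, |K i p.1 p.2 a b| * W p ≤ m i) :
    (Summable fun p : Site D × Site D => ∑ a, ∑ b, |(∑ i ∈ s, K i) p.1 p.2 a b| * W p) ∧
      ∑' p : Site D × Site D, ∑ a, ∑ b, |(∑ i ∈ s, K i) p.1 p.2 a b| * W p ≤ ∑ i ∈ s, m i := by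
  have hpt : ∀ p : Site D × Site D,
      ∑ a, ∑ b, |(∑ i ∈ s, K i) p.1 p.2 a b| * W p ≤ ∑ i ∈ s, ∑ a, ∑ b, |K i p.1 p.2 a b| * W p := by
    intro p
    calc ∑ a, ∑ b, |(∑ i ∈ s, K i) p.1 p.2 a b| * W p ≤ ∑ a, ∑ b, ∑ i ∈ s, |K i p.1 p.2 a b| * W p :=
          Finset.sum_le_sum fun a _ => Finset.sum_le_sum fun b _ => by
            rw [Finset.sum_apply, Finset.sum_apply, Finset.sum_apply, Finset.sum_apply, ← Finset.sum_mul]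
            exact mul_le_mul_of_nonneg_right (Finset.abs_sum_le_sum_abs _ _) (hW p)
      _ = ∑ a, ∑ i ∈ s, ∑ b, |K i p.1 p.2 a b| * W p := Finset.sum_congr rfl fun a _ => Finset.sum_comm
      _ = ∑ i ∈ s, ∑ a, ∑ b, |K i p.1 p.2 a b| * W p := Finset.sum_comm
  have h0 : ∀ p : Site D × Site D, 0 ≤ ∑ a, ∑ b, |(∑ i ∈ s, K i) p.1 p.2 a b| * W p := fun p =>
    Finset.sum_nonneg fun a _ => Finset.sum_nonneg fun b _ => mul_nonneg (abs_nonneg _) (hW p)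
  have hS : Summable fun p : Site D × Site D => ∑ i ∈ s, ∑ a, ∑ b, |K i p.1 p.2 a b| * W p := summable_sum fun i hi => hKs i hi
  refine ⟨Summable.of_nonneg_of_le h0 hpt hS, ?_⟩
  calc ∑' p : Site D × Site D, ∑ a, ∑ b, |(∑ i ∈ s, K i) p.1 p.2 a b| * W p
      ≤ ∑' p : Site D × Site D, ∑ i ∈ s, ∑ a, ∑ b, |K i p.1 p.2 a b| * W p := Summable.tsum_le_tsum hpt (Summable.of_nonneg_of_le h0 hpt hS) hS
    _ = ∑ i ∈ s, ∑' p : Site D × Site D, ∑ a, ∑ b, |K i p.1 p.2 a b| * W p := Summable.tsum_finsetSum fun i hi => hKs i hi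
    _ ≤ ∑ i ∈ s, m i := Finset.sum_le_sum hKm

/-- [folklore] **THE MASS OF A SCALAR MULTIPLE**: `Σ_{ab} |(c • K) p a b|·W p = |c|·(Σ_{ab} |K p a b|·W p)`. -/
theorem mass_smul_eq (c : ℝ) (K : MKer D F) (W : Site D × Site D → ℝ) (p : Site D × Site D) :
    ∑ a, ∑ b, |(c • K) p.1 p.2 a b| * W p = |c| * ∑ a, ∑ b, |K p.1 p.2 a b| * W p := by
  rw [Finset.mul_sum]
  refine Finset.sum_congr rfl fun a _ => ?_
  rw [Finset.mul_sum]
  refine Finset.sum_congr rfl fun b _ => ?_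
  rw [Pi.smul_apply, Pi.smul_apply, Pi.smul_apply, Pi.smul_apply, smul_eq_mul, abs_mul]
  ring

/-- [folklore] … hence a scalar multiple of a kernel with summable `W`-mass `≤ m` has summable `W`-mass `≤ |c|·m`. -/
theorem mass_smul_le {c : ℝ} {K : MKer D F} {W : Site D × Site D → ℝ} {m : ℝ}
    (hKs : Summable fun p : Site D × Site D => ∑ a, ∑ b, |K p.1 p.2 a b| * W p)
    (hKm : ∑' p : Site D × Site D, ∑ a, ∑ b, |K p.1 p.2 a b| * W p ≤ m) :
    (Summable fun p : Site D × Site D => ∑ a, ∑ b, |(c • K) p.1 p.2 a b| * W p) ∧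
      ∑' p : Site D × Site D, ∑ a, ∑ b, |(c • K) p.1 p.2 a b| * W p ≤ |c| * m := by
  have e : (fun p : Site D × Site D => ∑ a, ∑ b, |(c • K) p.1 p.2 a b| * W p)
      = fun p => |c| * ∑ a, ∑ b, |K p.1 p.2 a b| * W p := funext fun p => mass_smul_eq c K W p
  rw [e]
  refine ⟨hKs.mul_left _, ?_⟩
  rw [tsum_mul_left]
  exact mul_le_mul_of_nonneg_left hKm (abs_nonneg c)

end Generic

/-! ## §2 The two ghost stencils: two unit entries on the bond -/

section Stencils

/-- [folklore] **A SCALAR KERNEL DOMINATED BY TWO UNIT ENTRIES** at `(p₁, q₁)` and `(p₂, q₂)` has, for any nonnegative weight `W`, a summable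
`W`-mass `≤ W (p₁, q₁) + W (p₂, q₂)`. -/
theorem mass_le_of_two_entries {K : MKer 4 Unit} {W : Site 4 × Site 4 → ℝ} (hW : ∀ p, 0 ≤ W p) (p₁ q₁ p₂ q₂ : Site 4)
    (hK : ∀ x z, |K x z () ()| ≤ (if x = p₁ ∧ z = q₁ then (1 : ℝ) else 0) + (if x = p₂ ∧ z = q₂ then (1 : ℝ) else 0)) :
    (Summable fun p : Site 4 × Site 4 => ∑ a, ∑ b, |K p.1 p.2 a b| * W p) ∧
      ∑' p : Site 4 × Site 4, ∑ a, ∑ b, |K p.1 p.2 a b| * W p ≤ W (p₁, q₁) + W (p₂, q₂) := by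
  -- the majorant: two point masses
  set g : Site 4 × Site 4 → ℝ := fun p => (if p = (p₁, q₁) then W (p₁, q₁) else 0) + (if p = (p₂, q₂) then W (p₂, q₂) else 0) with hg
  have hgs : HasSum g (W (p₁, q₁) + W (p₂, q₂)) := (hasSum_ite_eq (p₁, q₁) (W (p₁, q₁))).add (hasSum_ite_eq (p₂, q₂) (W (p₂, q₂)))
  have h0 : ∀ p : Site 4 × Site 4, 0 ≤ ∑ a, ∑ b, |K p.1 p.2 a b| * W p := fun p =>
    Finset.sum_nonneg fun a _ => Finset.sum_nonneg fun b _ => mul_nonneg (abs_nonneg _) (hW p)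
  have hle : ∀ p : Site 4 × Site 4, ∑ a, ∑ b, |K p.1 p.2 a b| * W p ≤ g p := by
    rintro ⟨x, z⟩
    rw [Fintype.sum_unique, Fintype.sum_unique]
    show |K x z () ()| * W (x, z) ≤ g (x, z)
    refine (mul_le_mul_of_nonneg_right (hK x z) (hW (x, z))).trans ?_
    simp only [hg, Prod.mk.injEq, add_mul]
    refine add_le_add ?_ ?_
    · by_cases h : x = p₁ ∧ z = q₁
      · rw [if_pos h, if_pos h, h.1, h.2, one_mul]
      · rw [if_neg h, if_neg h, zero_mul]
    · by_cases h : x = p₂ ∧ z = q₂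
      · rw [if_pos h, if_pos h, h.1, h.2, one_mul]
      · rw [if_neg h, if_neg h, zero_mul]
  have hs := Summable.of_nonneg_of_le h0 hle hgs.summable
  exact ⟨hs, (hs.tsum_le_tsum hle hgs.summable).trans (le_of_eq hgs.tsum_eq)⟩

/-- [folklore] The current is dominated by its two unit entries `(u + e_κ, u)`, `(u, u + e_κ)`. -/
theorem abs_ghCur_le_two_entries (κ : Fin 4) (u x z : Site 4) :
    |ghCur κ u x z () ()| ≤ (if x = u + unitVec κ ∧ z = u then (1 : ℝ) else 0) + (if x = u ∧ z = u + unitVec κ then (1 : ℝ) else 0) := by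
  rw [ghCur_apply]
  refine (abs_sub _ _).trans (add_le_add ?_ ?_) <;> split_ifs <;> simp

/-- [folklore] The pair table is dominated by its two unit entries `(u, u + e_κ)`, `(u + e_κ, u)`. -/
theorem abs_gh₂_le_two_entries (κ : Fin 4) (u x z : Site 4) :
    |gh₂ κ u x z () ()| ≤ (if x = u ∧ z = u + unitVec κ then (1 : ℝ) else 0) + (if x = u + unitVec κ ∧ z = u then (1 : ℝ) else 0) := by
  rw [gh₂_apply, abs_neg]
  refine (abs_add_le _ _).trans (add_le_add ?_ ?_) <;> split_ifs <;> simp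

/-- [folklore] **THE MASS OF THE CURRENT**: `Σ'_p |ghCur κ u p|·W p ≤ W (u + e_κ, u) + W (u, u + e_κ)` (summable), any `0 ≤ W`. -/
theorem mass_ghCur_le {W : Site 4 × Site 4 → ℝ} (hW : ∀ p, 0 ≤ W p) (κ : Fin 4) (u : Site 4) :
    (Summable fun p : Site 4 × Site 4 => ∑ a, ∑ b, |ghCur κ u p.1 p.2 a b| * W p) ∧
      ∑' p : Site 4 × Site 4, ∑ a, ∑ b, |ghCur κ u p.1 p.2 a b| * W p ≤ W (u + unitVec κ, u) + W (u, u + unitVec κ) :=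
  mass_le_of_two_entries hW _ _ _ _ (fun x z => abs_ghCur_le_two_entries κ u x z)

/-- [folklore] **THE MASS OF THE PAIR TABLE**: `Σ'_p |gh₂ κ u p|·W p ≤ W (u, u + e_κ) + W (u + e_κ, u)` (summable), any `0 ≤ W`. -/
theorem mass_gh₂_le {W : Site 4 × Site 4 → ℝ} (hW : ∀ p, 0 ≤ W p) (κ : Fin 4) (u : Site 4) :
    (Summable fun p : Site 4 × Site 4 => ∑ a, ∑ b, |gh₂ κ u p.1 p.2 a b| * W p) ∧
      ∑' p : Site 4 × Site 4, ∑ a, ∑ b, |gh₂ κ u p.1 p.2 a b| * W p ≤ W (u, u + unitVec κ) + W (u + unitVec κ, u) :=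
  mass_le_of_two_entries hW _ _ _ _ (fun x z => abs_gh₂_le_two_entries κ u x z)

end Stencils

/-! ## §3 The packed jets as finite sums of single superpositions (structure only) -/

section Structure

open KernelSpecInstance (wH)
open Summit.QuantumFields.BalabanUV.Beta.D1BFx.ReducedKernelF (vertexRedF vertexRedF_apply)
open Summit.QuantumFields.BalabanUV.Beta.D1BFx.ReducedTableF (tableRedF tableRedF_apply)

/-- [folklore] The reduced vertex is the finite sum over colours of weighted superpositions (the `fun x z a b` of its definition commuted out). -/
theorem vertexRedF_eq_sum {F : Type*} (n : ℕ) [NeZero n] (S : Fin 4 → Site 4 → MKer 4 F) (μ : Fin 4) (y : Site 4) :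
    vertexRedF n S μ y = ∑ κ' : Fin 4, wsum (fun u => wH (N := n) (d := 3) κ' μ (u - (n : ℤ) • y)) (S κ') := by
  funext x z a b
  rw [vertexRedF_apply, Finset.sum_apply, Finset.sum_apply, Finset.sum_apply, Finset.sum_apply]

/-- [folklore] The inner superposition against the DIAGONAL table collapses: `wsum w′ (u′ ↦ [u = u′][κ′ = l′]•gh₂ κ′ u) = ([κ′ = l′]·w′ u) • gh₂ κ′ u`
(`tsum_eq_single u`). -/
theorem wsum_diag_table (w' : Site 4 → ℝ) (κ' l' : Fin 4) (u : Site 4) :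
    wsum w' (fun u' => if u = u' ∧ κ' = l' then gh₂ κ' u else 0) = (if κ' = l' then w' u else 0) • gh₂ κ' u := by
  funext x z a b
  unfold OneStepResolventKernel.wsum
  rw [tsum_eq_single u]
  · by_cases h : κ' = l'
    · simp [h]
    · simp [h]
  · intro u' hu'
    have h : ¬(u = u' ∧ κ' = l') := fun hh => hu' hh.1.symm
    simp [h]

/-- [folklore] **THE PACKED DIAGONAL TABLE AS SIXTEEN SINGLE SUPERPOSITIONS**: `tableRedF n ([u = u′][κ = l]•gh₂) μ y ν y′
= Σ_{κ′} Σ_{l′} wsum (u ↦ wH κ′ μ (u − n•y)·([κ′ = l′]·wH l′ ν (u − n•y′))) (gh₂ κ′)` (the product weight absorbs the collapsed inner step). -/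
theorem tableRedF_gh11_eq_sum (n : ℕ) [NeZero n] (μ : Fin 4) (y : Site 4) (ν : Fin 4) (y' : Site 4) :
    tableRedF n (fun κ u l u' => if u = u' ∧ κ = l then gh₂ κ u else 0) μ y ν y'
      = ∑ κ' : Fin 4, ∑ l' : Fin 4,
          wsum (fun u => wH (N := n) (d := 3) κ' μ (u - (n : ℤ) • y) * (if κ' = l' then wH (N := n) (d := 3) l' ν (u - (n : ℤ) • y') else 0))
            (fun u => gh₂ κ' u) := by
  funext x z a b
  rw [tableRedF_apply, Finset.sum_apply, Finset.sum_apply, Finset.sum_apply, Finset.sum_apply]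
  refine Finset.sum_congr rfl fun κ' _ => ?_
  rw [Finset.sum_apply, Finset.sum_apply, Finset.sum_apply, Finset.sum_apply]
  refine Finset.sum_congr rfl fun l' _ => ?_
  show (∑' u : Site 4, wH (N := n) (d := 3) κ' μ (u - (n : ℤ) • y)
      * wsum (fun u' => wH (N := n) (d := 3) l' ν (u' - (n : ℤ) • y')) (fun u' => if u = u' ∧ κ' = l' then gh₂ κ' u else 0) x z a b)
    = ∑' u : Site 4, (wH (N := n) (d := 3) κ' μ (u - (n : ℤ) • y) * (if κ' = l' then wH (N := n) (d := 3) l' ν (u - (n : ℤ) • y') else 0))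
      * gh₂ κ' u x z a b
  refine tsum_congr fun u => ?_
  rw [wsum_diag_table, Pi.smul_apply, Pi.smul_apply, Pi.smul_apply, Pi.smul_apply, smul_eq_mul, mul_assoc]

end Structure

end Summit.QuantumFields.BalabanUV.Beta.D1BFx.GhostWordJetMass

end
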